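import Literature.Analysis.FluidPDE.OseenDuhamelEnergyBound
import Literature.Analysis.FluidPDE.ClayForceLerayProjection
import Literature.Analysis.FluidPDE.ForcedFourierForceDataSobolev
import HarnessLib

/-!
# A pointwise bound for bounded classical finite-energy solutions of the FORCED Navier–Stokes system
# through the ENERGY of the flow, its sup norm, and the `L²` size of the force

Analysis/FluidPDE proof file (theorems only; no definitions, no named facts). Companion of
`ForcedOseenRepresentationClassical.lean` and second half of `OseenDuhamelEnergyBound.lean`. The
forced Oseen representation `u(t) = e^{νtΔ}u(0) - B^ν_0(u,u)(t) + ∫₀ᵗ e^{ν(t-τ)Δ} g(τ) dτ` of a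
bounded classical finite-energy solution `(u, p)` on `[0, T] × ℝ³` driven by a jointly continuous,
bounded, weakly divergence-free force `g` with `‖g(τ)‖₂ ≤ G₂`
(`IsClassicalNSSolutionOn.ae_eq_forced_oseenMild`) is read with the three energy-weighted sizes of
`OseenDuhamelEnergyBound.lean`:

* `exists_norm_le_of_energy_forced` — **the energy-weighted pointwise bound**: a universal `C > 0`
  with `‖u(s, x)‖ ≤ E₂ (νs)^{-3/4} + C ν^{-7/8} s^{1/8} M^{3/2} E₂^{1/2} + 4 ν^{-3/4} s^{1/4} G₂` for
  `0 < s ≤ T` and every `x`, whenever `‖u‖ ≤ M` on the slab and `‖u(τ)‖₂ ≤ E₂` for `τ ∈ [0, T]`.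
  Unlike Leray's short-time bound (`exists_norm_le_sup_add_sqrt_add_force`) this is SMALL,
  uniformly on a window of fixed length, when the energy and the force size are small while the sup
  norm is only bounded;
* `eLpNorm_two_clayProjForce_le` — the intended force input: the Leray projection `P f` of a
  Schwartz-on-slab force (`clayProjForce`, `ClayForceLerayProjection.lean`) has
  `‖P f(t)‖₂ ≤ ‖f(clamp T t)‖₂` (Plancherel, `FourierNS.lintegral_levelSq_synthVel_eq_of_moments` at
  order `0`, and the pointwise `ℓ²`-contraction of the symbol, `FourierNS.sum_enorm_sq_lerayPart_le`)
  — the quantitative companion of `exists_eLpNorm_two_clayProjForce_le`.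

This is the shape consumed by the cell `ns-blowup`'s negative lane for the crux `EpisodeBase`: a
registered level-`0` host of tiny energy cannot be pushed to the level-`1` speed floor inside the
rigid window, whatever the admissible (bounded, ball-confined) push. Mechanism: Leray 1934 §19–§21
(a-priori sup-norm control through the integral equation) with Kato's `Lᵖ` kernel sizes.

Cell `ns-blowup` labels: LABEL Literature port (a-priori estimate for GIVEN solutions); bears_on
LADDER-NS N1 (route-NavierStokesRegularity-PalasekTowerBreakdown, crux stmt-NavierStokesRegularity-19179
`EpisodeBase`, negative lane of the ∀-placeholder `FirstEpisodeR`); WHAT THIS IS NOT: not NS — a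
pointwise bound for GIVEN bounded classical solutions of the forced system; nothing about regularity
or blow-up is asserted.

## Mathlib / tree search

Tree: `IsClassicalNSSolutionOn.ae_eq_forced_oseenMild` (`ForcedOseenRepresentationClassical`);
`norm_heatExtension_le_of_eLpNorm_two`, `norm_forceDuhamel_le_of_eLpNorm_two`,
`exists_norm_oseenDuhamel_le_of_energy` (`OseenDuhamelEnergyBound`); `clayProjForce`,
`exists_eLpNorm_two_clayProjForce_le` (`ClayForceLerayProjection`);
`FourierNS.lintegral_levelSq_synthVel_eq_of_moments`, `levelSq_zero_eq_norm_sq`,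
`synthVel_forceData`, `hasDecay_forceData_uniform`, `hasDecay_lerayPart_forceData_uniform`,
`forceData_conj_symm`, `lerayPart_forceData_conj_symm`, `FourierNS.sum_enorm_sq_lerayPart_le`
(`ForcedFourierForceData(Sobolev)`, `ForcedFourierForcePressureData`, `TaoH1FourierMildClassical`);
`forall_norm_le_of_ae_norm_le` (`NSLerayBlowupRateLpProofs`). The sup-norm twins are
`exists_norm_le_heat_add_volterra_add_force` / `exists_norm_le_sup_add_sqrt_add_force`
(`lean search 'volterra_add_force|sqrt_add_force|le_of_energy_forced|clayProjForce_le'`: no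
energy-weighted bound and no quantitative `L²` bound of `P f` existed). Mathlib:
`ENNReal.rpow_le_rpow`, `integrable_inv_one_add_norm_pow`, `memLp_two_iff_integrable_sq`.

## References

* J. Leray, Acta Math. 63 (1934), §19 (3.4)–(3.8), §21 (3.5). [Leray1934]
* T. Kato, Math. Z. 187 (1984) 471–480, §2, (2.3)–(2.4′). [Kato1984]
* P. G. Lemarié-Rieusset, *The Navier–Stokes Problem in the 21st Century*, CRC Press (2016), §6.1,
  Prop. 6.4 (6.10), Thm. 6.1 (6.12). [LemarieRieusset2016]
* T. Tao, Anal. PDE 6 (2013) 25–107 = arXiv:1108.1165, (7)–(8) p. 3; Thm. 5.4 proof. [Tao2011]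
-/

noncomputable section

open MeasureTheory TopologicalSpace Set Function Filter
open _root_.Topology
open scoped InnerProductSpace RealInnerProductSpace ENNReal NNReal

namespace Literature.Analysis.FluidPDE

/-! ### The `L²` size of the projected Clay force -/

section ProjectedForce

open FourierNS

variable {T : ℝ} {f : ℝ → EuclideanSpace ℝ (Fin 3) → EuclideanSpace ℝ (Fin 3)}
  (hT : 0 < T) (hf : IsSmoothSpaceTimeOn (Icc 0 T) f) (hd : HasUniformRapidDecayOn (Icc 0 T) f)

/-- Plancherel for a Schwartz-on-slab force and for its Leray part, at order `0`: for
`V ∈ {b̂_f(t), P b̂_f(t)}`, `∫ |Re 𝓕 V|² = ∫ Σₗ |Vₗ|²` (`lintegral_levelSq_synthVel_eq_of_moments` with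
`m = 0`, fed with the polynomial decay of the Fourier-side force). [cite: Tao2011, Thm. 5.4 proof (arXiv Thm. 31, p. 18)] -/
private theorem lintegral_sq_synthVel_eq_of_decay {V : EuclideanSpace ℝ (Fin 3) → Fin 3 → ℂ}
    (hmeas : ∀ l, AEStronglyMeasurable (fun ξ => V ξ l) volume)
    (hdec : ∀ K : ℕ, ∃ B : ℝ, 0 ≤ B ∧ HasDecay K B V)
    (hconj : ∀ ξ l, V (-ξ) l = (starRingEnd ℂ) (V ξ l)) :
    ∫⁻ x, ‖synthVel V x‖ₑ ^ 2 = ∫⁻ ξ, ∑ l, ‖V ξ l‖ₑ ^ 2 := by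
  have hdim4 : Module.finrank ℝ (EuclideanSpace ℝ (Fin 3)) < 4 := by
    rw [finrank_euclideanSpace, Fintype.card_fin]; norm_num
  obtain ⟨B, hB0, hB⟩ := hdec 2
  have hGsq : ∀ ξ : EuclideanSpace ℝ (Fin 3), (B * ((1 + ‖ξ‖) ^ 2)⁻¹) ^ 2 = B ^ 2 * ((1 + ‖ξ‖) ^ 4)⁻¹ := by
    intro ξ
    have h1 : 0 < 1 + ‖ξ‖ := by positivity
    field_simp
  have hGint : Integrable (fun ξ : EuclideanSpace ℝ (Fin 3) => (B * ((1 + ‖ξ‖) ^ 2)⁻¹) ^ 2) volume := by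
    simp_rw [hGsq]
    exact (integrable_inv_one_add_norm_pow hdim4).const_mul _
  have hpow : Continuous fun ξ : EuclideanSpace ℝ (Fin 3) => (1 + ‖ξ‖) ^ 2 :=
    (continuous_const.add continuous_norm).pow 2
  have hGcont : Continuous fun ξ : EuclideanSpace ℝ (Fin 3) => B * ((1 + ‖ξ‖) ^ 2)⁻¹ :=
    continuous_const.mul (hpow.inv₀ fun ξ => by positivity)
  have hGmem : ∀ _l : Fin 3, MemLp (fun ξ : EuclideanSpace ℝ (Fin 3) => B * ((1 + ‖ξ‖) ^ 2)⁻¹) 2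
      (volume : Measure (EuclideanSpace ℝ (Fin 3))) := fun _ =>
    (memLp_two_iff_integrable_sq hGcont.aestronglyMeasurable).2 hGint
  have hmom : ∀ (k : ℕ) (l : Fin 3),
      Integrable (fun ξ : EuclideanSpace ℝ (Fin 3) => ‖ξ‖ ^ k * ‖V ξ l‖) volume := by
    intro k l
    obtain ⟨B', -, hB'⟩ := hdec (k + 4)
    exact (hB'.apply l).integrable_pow_mul_norm hdim4 (hmeas l)
  have hle : ∀ ξ l, ‖ξ‖ ^ 0 * ‖V ξ l‖ ≤ (fun (_ : Fin 3) (ξ : EuclideanSpace ℝ (Fin 3)) =>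
      B * ((1 + ‖ξ‖) ^ 2)⁻¹) l ξ := fun ξ l => by
    rw [pow_zero, one_mul]; exact hB.apply l ξ
  have hP := lintegral_levelSq_synthVel_eq_of_moments V hmeas hmom hconj 0 hGmem hle
  have heq : ∀ x, ‖synthVel V x‖ₑ ^ 2 = ENNReal.ofReal (levelSq 0 (synthVel V) x) := by
    intro x
    rw [levelSq_zero_eq_norm_sq, ← ofReal_norm, ← ENNReal.ofReal_pow (norm_nonneg _)]
  simp_rw [heq]
  rw [hP]
  simp

/-- **The Leray projection does not increase the `L²` size of the force**: for every real `t`,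
`‖P f(t)‖₂ ≤ ‖f(clamp T t)‖₂` (Plancherel on both sides and the pointwise `ℓ²`-contraction of the
symbol `1 - ξ ⊗ ξ/|ξ|²`, `FourierNS.sum_enorm_sq_lerayPart_le`). The quantitative companion of
`exists_eLpNorm_two_clayProjForce_le`. [cite: LemarieRieusset2016, §6.1] [cite: Tao2011, (8) p. 3] -/
theorem eLpNorm_two_clayProjForce_le (t : ℝ) :
    eLpNorm (clayProjForce hT hf hd t) 2 volume ≤ eLpNorm (f (clamp T t)) 2 volume := by
  -- Plancherel for `P f(t)` and for `f(clamp T t)`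
  have hV := lintegral_sq_synthVel_eq_of_decay
    (V := fun ξ => lerayPart (forceData hT hf hd t) ξ)
    (aestronglyMeasurable_lerayPart_forceData_apply hT hf hd t)
    (fun K => hasDecay_lerayPart_forceData_uniform hT hf hd K |>.imp fun B h => ⟨h.1, h.2 t⟩)
    (lerayPart_forceData_conj_symm hT hf hd t)
  have hW := lintegral_sq_synthVel_eq_of_decay (V := forceData hT hf hd t)
    (fun l => ((continuous_apply l).comp (continuous_forceData_slice hT hf hd t)).aestronglyMeasurable)
    (fun K => hasDecay_forceData_uniform hT hf hd K |>.imp fun B h => ⟨h.1, h.2 t⟩)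
    (forceData_conj_symm hT hf hd t)
  have hsq : ∫⁻ x, ‖clayProjForce hT hf hd t x‖ₑ ^ 2 ≤ ∫⁻ x, ‖f (clamp T t) x‖ₑ ^ 2 := by
    have h1 : ∫⁻ x, ‖clayProjForce hT hf hd t x‖ₑ ^ 2 =
        ∫⁻ ξ, ∑ l, ‖lerayPart (forceData hT hf hd t) ξ l‖ₑ ^ 2 := hV
    have h2 : ∫⁻ x, ‖f (clamp T t) x‖ₑ ^ 2 = ∫⁻ ξ, ∑ l, ‖forceData hT hf hd t ξ l‖ₑ ^ 2 := by
      rw [← synthVel_forceData hT hf hd t]; exact hW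
    rw [h1, h2]
    exact lintegral_mono fun ξ => sum_enorm_sq_lerayPart_le _ ξ
  have hroot : ∀ g : EuclideanSpace ℝ (Fin 3) → EuclideanSpace ℝ (Fin 3),
      eLpNorm g 2 volume = (∫⁻ x, ‖g x‖ₑ ^ 2) ^ (1 / (2 : ℝ)) := by
    intro g
    rw [eLpNorm_eq_lintegral_rpow_enorm_toReal two_ne_zero ENNReal.ofNat_ne_top, ENNReal.toReal_ofNat]
    congr 1
    refine lintegral_congr fun x => ?_
    rw [← ENNReal.rpow_natCast]
    norm_num
  rw [hroot, hroot]
  exact ENNReal.rpow_le_rpow hsq (by norm_num)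

end ProjectedForce

/-! ### The pointwise bound through energy, sup norm and force size -/

section Classical

/-- **The energy-weighted pointwise bound for bounded classical solutions of the FORCED system.**
There is a universal `C > 0` such that for every `ν > 0`, `T > 0`, every classical solution `(u, p)`
of the Navier–Stokes system on `[0, T] × ℝ³` driven by a jointly continuous force `g` (slices bounded
by `G`, weakly divergence free, `‖g(τ)‖₂ ≤ G₂`, `0 ≤ G₂`), with finite energy, `‖u‖ ≤ M` on the slab
and `‖u(τ)‖₂ ≤ E₂` for `τ ∈ [0, T]` (`0 ≤ E₂`): for all `s ∈ (0, T]` and every `x`,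

  `‖u(s, x)‖ ≤ E₂ (νs)^{-3/4} + C ν^{-7/8} s^{1/8} M^{3/2} E₂^{1/2} + 4 ν^{-3/4} s^{1/4} G₂`

(heat term `eLpNorm_top_heatExtension_le_of_Lr` with `r = 2`; Duhamel term
`exists_norm_oseenDuhamel_le_of_energy`; force term `norm_forceDuhamel_le_of_eLpNorm_two`; a.e. from
the representation `IsClassicalNSSolutionOn.ae_eq_forced_oseenMild`, everywhere by continuity of
`u(s)`). Leray's a-priori control of the sup norm through the integral equation, read with Kato's
`Lᵖ` sizes of the Oseen kernel so that the nonlinear term is of order `M^{3/2} E₂^{1/2}` instead of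
`M²`. [cite: Leray1934, §19 (3.4)–(3.8), §21 (3.5)] [cite: Kato1984, (2.3)–(2.4')]
[cite: LemarieRieusset2016, Thm. 6.1 (6.12) with Prop. 6.4 (6.10)] -/
theorem exists_norm_le_of_energy_forced :
    ∃ C : ℝ, 0 < C ∧ ∀ {ν T M G E₂ G₂ : ℝ}
      {g u : ℝ → EuclideanSpace ℝ (Fin 3) → EuclideanSpace ℝ (Fin 3)}
      {p : ℝ → EuclideanSpace ℝ (Fin 3) → ℝ},
      0 < ν → 0 < T →
      IsClassicalNSSolutionOn (Icc 0 T) ν g u p → Continuous (uncurry g) →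
      (∀ τ ∈ Icc 0 T, ∀ y, ‖g τ y‖ ≤ G) → (∀ τ ∈ Icc 0 T, IsWeaklyDivFree (g τ)) →
      0 ≤ G₂ → (∀ τ ∈ Icc 0 T, eLpNorm (g τ) 2 volume ≤ ENNReal.ofReal G₂) →
      (∃ C : ℝ≥0∞, C < ⊤ ∧ ∀ t ∈ Icc 0 T, ∫⁻ x, ‖u t x‖ₑ ^ 2 ≤ C) →
      0 < M → (∀ s ∈ Icc 0 T, ∀ y, ‖u s y‖ ≤ M) →
      0 ≤ E₂ → (∀ s ∈ Icc 0 T, eLpNorm (u s) 2 volume ≤ ENNReal.ofReal E₂) →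
      ∀ s ∈ Ioc 0 T, ∀ x,
        ‖u s x‖ ≤ E₂ * (ν * s) ^ (-(3 / 4 : ℝ)) +
          C * ν ^ (-(7 / 8 : ℝ)) * s ^ (1 / 8 : ℝ) * (M ^ (3 / 2 : ℝ) * E₂ ^ (1 / 2 : ℝ)) +
          4 * ν ^ (-(3 / 4 : ℝ)) * s ^ (1 / 4 : ℝ) * G₂ := by
  obtain ⟨C, hC, hDuh⟩ := exists_norm_oseenDuhamel_le_of_energy
  refine ⟨C, hC, ?_⟩
  intro ν T M G E₂ G₂ g u p hν hT hcl hgc hG hgdiv hG₂ hg2 hE hM hMb hE₂ hE₂b s hs x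
  have hs0 : 0 < s := hs.1
  have hνs : 0 < ν * s := mul_pos hν hs0
  have hsI : s ∈ Icc 0 T := ⟨hs.1.le, hs.2⟩
  have h0I : (0 : ℝ) ∈ Icc 0 T := ⟨le_rfl, hT.le⟩
  -- ### slices
  have hslc : ∀ τ ∈ Icc 0 T, Continuous (u τ) := fun τ hτ =>
    (hcl.contDiff_velocity hτ).continuous
  have hsl : ∀ τ ∈ Icc 0 T, AEStronglyMeasurable (u τ) volume := fun τ hτ =>
    (hslc τ hτ).aestronglyMeasurable
  have hgslc : ∀ τ, Continuous (g τ) := fun τ => hgc.comp (continuous_const.prodMk continuous_id)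
  have hgmem : ∀ τ ∈ Icc 0 T, MemLp (g τ) 2 volume := fun τ hτ =>
    ⟨(hgslc τ).aestronglyMeasurable, (hg2 τ hτ).trans_lt ENNReal.ofReal_lt_top⟩
  -- ### the representation formula at time `s`
  have hrep := hcl.ae_eq_forced_oseenMild hν hT hgc hG hgdiv ENNReal.ofReal_ne_top hg2 hE hM hMb hs
  -- ### the heat term
  have ha0 : 0 ≤ E₂ * (ν * s) ^ (-(3 / 4 : ℝ)) := mul_nonneg hE₂ (Real.rpow_nonneg hνs.le _)
  have hmem0 : MemLp (u 0) 2 volume :=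
    ⟨hsl 0 h0I, (hE₂b 0 h0I).trans_lt ENNReal.ofReal_lt_top⟩
  have hheat : ∀ y, ‖UnboundedOperators.heatExtension (u 0) (ν * s) y‖ ≤ E₂ * (ν * s) ^ (-(3 / 4 : ℝ)) :=
    fun y => norm_heatExtension_le_of_eLpNorm_two hmem0 hE₂ (hE₂b 0 h0I) hνs y
  -- ### the Duhamel term
  have hB : ∀ y, ‖oseenDuhamel ν 0 u u s y‖ ≤
      C * ν ^ (-(7 / 8 : ℝ)) * s ^ (1 / 8 : ℝ) * (M ^ (3 / 2 : ℝ) * E₂ ^ (1 / 2 : ℝ)) := fun y =>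
    hDuh hν hs0 hM.le hE₂ (fun τ hτ => hsl τ ⟨hτ.1.le, hτ.2.le.trans hs.2⟩)
      (fun τ hτ z => hMb τ ⟨hτ.1.le, hτ.2.le.trans hs.2⟩ z)
      (fun τ hτ => hE₂b τ ⟨hτ.1.le, hτ.2.le.trans hs.2⟩) y
  -- ### the force term
  have hF : ∀ y, ‖forceDuhamel ν 0 g s y‖ ≤ 4 * ν ^ (-(3 / 4 : ℝ)) * s ^ (1 / 4 : ℝ) * G₂ := fun y =>
    norm_forceDuhamel_le_of_eLpNorm_two hν hs0 hG₂
      (fun τ hτ => hgmem τ ⟨hτ.1.le, hτ.2.le.trans hs.2⟩)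
      (fun τ hτ => hg2 τ ⟨hτ.1.le, hτ.2.le.trans hs.2⟩) y
  -- ### the bound a.e., then everywhere by continuity of `u s`
  have hae : ∀ᵐ y ∂(volume : Measure (EuclideanSpace ℝ (Fin 3))),
      ‖u s y‖ ≤ E₂ * (ν * s) ^ (-(3 / 4 : ℝ)) +
        C * ν ^ (-(7 / 8 : ℝ)) * s ^ (1 / 8 : ℝ) * (M ^ (3 / 2 : ℝ) * E₂ ^ (1 / 2 : ℝ)) +
        4 * ν ^ (-(3 / 4 : ℝ)) * s ^ (1 / 4 : ℝ) * G₂ := by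
    filter_upwards [hrep] with y hy
    rw [hy]
    calc ‖UnboundedOperators.heatExtension (u 0) (ν * s) y - oseenDuhamel ν 0 u u s y +
          forceDuhamel ν 0 g s y‖
        ≤ ‖UnboundedOperators.heatExtension (u 0) (ν * s) y - oseenDuhamel ν 0 u u s y‖ +
          ‖forceDuhamel ν 0 g s y‖ := norm_add_le _ _
      _ ≤ (‖UnboundedOperators.heatExtension (u 0) (ν * s) y‖ + ‖oseenDuhamel ν 0 u u s y‖) +
          ‖forceDuhamel ν 0 g s y‖ := by gcongr; exact norm_sub_le _ _
      _ ≤ (E₂ * (ν * s) ^ (-(3 / 4 : ℝ)) +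
          C * ν ^ (-(7 / 8 : ℝ)) * s ^ (1 / 8 : ℝ) * (M ^ (3 / 2 : ℝ) * E₂ ^ (1 / 2 : ℝ))) +
          4 * ν ^ (-(3 / 4 : ℝ)) * s ^ (1 / 4 : ℝ) * G₂ :=
          add_le_add (add_le_add (hheat y) (hB y)) (hF y)
  exact forall_norm_le_of_ae_norm_le (hslc s hsI) hae x

end Classical

end Literature.Analysis.FluidPDE

end
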